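import Summits.CriticalPhenomena.PercolationContinuityZ3.Theorems.PercNearOneGluingNoHeavyConstsThreePointSKProof
import HarnessLib

/-!
# The covariance form of SK3 and the Gladkov–Zimin three-point continuity conjecture

builds on p205010 (kernel theorem, internal audit signed; external expert review pending)

Lane `prim/consts`, seat prim-consts-1 gen 14 (memo `FROM-prim-consts-1-g14-SK3.md` §5), support file for the crux `NoHeavyLowerTail`
(stmt-CriticalPhenomena-4575; `--supports`): one `Prop` definition (an OPEN statement from the literature, tagged `@[conjecture]`) and
theorems; no sorries; standard axioms.  Nothing here claims the conjecture.

Notation (three vertices `a, b, c`, `μ = prodBernoulli w`): `s = μ(a|b|c)`, `j_a = μ(a alone)`, `j_b`, `j_c`, `k = μ(abc)`.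
* `Consts.SK3.real_five_types` — the five partition types have total mass `1`.
* `Consts.SK3.real_conn_eq` — `μ(c ⟷ a) = k + j_b` (the pair `{a, c}` is joined exactly in the types `abc` and "`b` alone").
* `Consts.SK3.sk_sub_eq_cov` — **the covariance form**: `s·k − j_a·j_b = Cov(1_{c ⟷ a}, 1_{c ⟷ b}) − k·j_c`, i.e. the Ahlswede–Daykin gap of the
  pair (`a` alone, `b` alone) is the Harris covariance of the two connections AT `c` minus `k·j_c`.
* `Consts.SK3.alone_mul_sum_le_gap` — from SK3 (`Consts.threePointSK_holds`): `j_c·(j_a + j_b) ≤ s·k − j_a·j_b`; with the covariance form,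
  `Cov(1_{c ⟷ a}, 1_{c ⟷ b}) ≥ j_c·(k + j_a + j_b) = μ(a ⟷ b, c alone)·μ(c ⟷ a or c ⟷ b)` (`Consts.SK3.cov_conn_ge`) — a quantified Harris inequality.
* `Consts.ThreePointGapContinuity` — **CONJECTURE (Gladkov 2024, Conj. 10.1 = Gladkov–Zimin 2024, Conj. 6.3), OPEN**: for every `ε > 0` there is
  `δ > 0` such that on every finite weighted graph `μ(a ⟷ b, c alone) < δ ⟹ s·k − j_a·j_b < ε`.  SK3 is the matching LOWER bound
  (`s k − j_a j_b ≥ j_c (j_a + j_b) ≥ 0`); the conjecture asks for an upper bound vanishing with `j_c`.  Numerics of this seat (memo §5(iv), floats with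
  exact re-checks, graphs on ≤ 8 vertices): `(s k − j_a j_b)/j_c` is NOT bounded by `1` (exact value `2.853` on a 6-vertex graph) but
  `(s k − j_a j_b) ≤ 0.52·(j_c + √(j_c s k))` in every climbed instance, and `(s k − j_a j_b)² ≤ j_c s k` fails only by `6·10⁻⁴` — recorded as the
  quantitative candidate; no proof is claimed.
References: N. Gladkov, *Percolation inequalities and decision trees*, arXiv:2408.08457 (2024), Thm. 1.3 and Conjecture 10.1; N. Gladkov,
A. Zimin, arXiv:2404.08873 (2024), Conj. 6.3; R. Ahlswede, D. E. Daykin (1978); T. E. Harris (1960).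
-/

noncomputable section

namespace Summit.CriticalPhenomena.PercolationContinuityZ3.Theorems

open MeasureTheory Set Literature.Probability.LatticeModels Literature.Probability.Percolation
open scoped Classical

namespace Consts

namespace SK3

variable {V : Type*}

/-- Notation (this file only): `𝐉[a, b, c]` = "`a` alone" (`a ↮ b`, `a ↮ c`, `b ⟷ c`). -/
local notation3 "𝐉[" a ", " b ", " c "]" =>
  ((openConn a b)ᶜ ∩ (openConn a c)ᶜ ∩ openConn b c : Set (BondConfig _))

/-- Notation (this file only): `𝐒[a, b, c]` = "all three separated". -/
local notation3 "𝐒[" a ", " b ", " c "]" =>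
  ((openConn a b)ᶜ ∩ (openConn a c)ᶜ ∩ (openConn b c)ᶜ : Set (BondConfig _))

/-- Notation (this file only): `𝐊[a, b, c]` = "all three joined". -/
local notation3 "𝐊[" a ", " b ", " c "]" =>
  (openConn a b ∩ openConn a c ∩ openConn b c : Set (BondConfig _))

variable [Fintype V]

/-- **The five partition types have total mass one**: `s + j_a + j_b + j_c + k = 1`. [folklore] -/
theorem real_five_types (μ : Measure (BondConfig V)) [IsProbabilityMeasure μ] (a b c : V) :
    μ.real 𝐒[a, b, c] + μ.real 𝐉[a, b, c] + μ.real 𝐉[b, a, c] + μ.real 𝐉[c, a, b] + μ.real 𝐊[a, b, c] = 1 := by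
  have hmeas : ∀ U : Set (BondConfig V), MeasurableSet U := fun _ => MeasurableSet.of_discrete
  -- pairwise disjointness, via reachability
  have dSJa : Disjoint (𝐒[a, b, c] : Set (BondConfig V)) 𝐉[a, b, c] := by
    rw [disjoint_left]; rintro ω h1 h2
    simp only [mem_inter_iff, mem_compl_iff, openConn, mem_setOf_eq] at h1 h2; exact h1.2 h2.2
  have dU1Jb : Disjoint (𝐒[a, b, c] ∪ 𝐉[a, b, c] : Set (BondConfig V)) 𝐉[b, a, c] := by
    rw [disjoint_left]; rintro ω (h1 | h1) h2 <;>
      simp only [mem_inter_iff, mem_compl_iff, openConn, mem_setOf_eq] at h1 h2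
    · exact h1.1.2 h2.2
    · exact h2.1.2 h1.2
  have dU2Jc : Disjoint (𝐒[a, b, c] ∪ 𝐉[a, b, c] ∪ 𝐉[b, a, c] : Set (BondConfig V)) 𝐉[c, a, b] := by
    rw [disjoint_left]; rintro ω ((h1 | h1) | h1) h2 <;>
      simp only [mem_inter_iff, mem_compl_iff, openConn, mem_setOf_eq] at h1 h2
    · exact h1.1.1 h2.2
    · exact h1.1.1 h2.2
    · exact h2.1.1 h1.2.symm
  have dU3K : Disjoint (𝐒[a, b, c] ∪ 𝐉[a, b, c] ∪ 𝐉[b, a, c] ∪ 𝐉[c, a, b] : Set (BondConfig V)) 𝐊[a, b, c] := by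
    rw [disjoint_left]; rintro ω (((h1 | h1) | h1) | h1) h2 <;>
      simp only [mem_inter_iff, mem_compl_iff, openConn, mem_setOf_eq] at h1 h2
    · exact h1.1.1 h2.1.1
    · exact h1.1.1 h2.1.1
    · exact h1.1.1 h2.1.1.symm
    · exact h1.1.1 h2.1.2.symm
  have hcover : (𝐒[a, b, c] ∪ 𝐉[a, b, c] ∪ 𝐉[b, a, c] ∪ 𝐉[c, a, b] ∪ 𝐊[a, b, c] : Set (BondConfig V)) = univ := by
    ext ω
    simp only [mem_union, mem_univ, iff_true]
    rcases mem_five_types ω a b c with h | h | h | h | h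
    · exact Or.inl (Or.inl (Or.inl (Or.inl h)))
    · exact Or.inr h
    · exact Or.inl (Or.inl (Or.inl (Or.inr h)))
    · exact Or.inl (Or.inl (Or.inr h))
    · exact Or.inl (Or.inr h)
  have h := congrArg μ.real hcover
  rw [measureReal_union dU3K (hmeas _), measureReal_union dU2Jc (hmeas _), measureReal_union dU1Jb (hmeas _),
    measureReal_union dSJa (hmeas _), probReal_univ] at h
  exact h

/-- `μ(c ⟷ a) = k + j_b`: the pair `{a, c}` is joined exactly in the types "all joined" and "`b` alone". [folklore] -/
theorem real_conn_eq (μ : Measure (BondConfig V)) [IsFiniteMeasure μ] (a b c : V) :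
    μ.real (openConn c a) = μ.real 𝐊[a, b, c] + μ.real 𝐉[b, a, c] := by
  have hmeas : ∀ U : Set (BondConfig V), MeasurableSet U := fun _ => MeasurableSet.of_discrete
  have hset : (openConn c a : Set (BondConfig V)) = 𝐊[a, b, c] ∪ 𝐉[b, a, c] := by
    ext ω
    simp only [mem_union, mem_inter_iff, mem_compl_iff, openConn, mem_setOf_eq]
    constructor
    · intro hca
      by_cases hab : (openGraph ω).Reachable a b
      · exact Or.inl ⟨⟨hab, hca.symm⟩, hab.symm.trans hca.symm⟩
      · exact Or.inr ⟨⟨fun h => hab h.symm, fun h => hab (hca.symm.trans h.symm)⟩, hca.symm⟩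
    · rintro (⟨⟨-, hac⟩, -⟩ | ⟨-, hac⟩) <;> exact hac.symm
  have hdis : Disjoint (𝐊[a, b, c] : Set (BondConfig V)) 𝐉[b, a, c] := by
    rw [disjoint_left]; rintro ω h1 h2
    simp only [mem_inter_iff, mem_compl_iff, openConn, mem_setOf_eq] at h1 h2
    exact h2.1.1 h1.1.1.symm
  rw [hset, measureReal_union hdis (hmeas _)]

/-- **The covariance form of the Ahlswede–Daykin gap.**  For three vertices `a, b, c`:
`s·k − j_a·j_b = [μ(c ⟷ a, c ⟷ b) − μ(c ⟷ a)·μ(c ⟷ b)] − k·j_c` — the gap of the pair ("`a` alone", "`b` alone") is the Harris covariance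
of the two connections at `c` minus `k·μ(a ⟷ b, c alone)`.  Pure bookkeeping on the five-type partition.
[cite: AhlswedeDaykin1978, Theorem 1] -/
theorem sk_sub_eq_cov (μ : Measure (BondConfig V)) [IsProbabilityMeasure μ] (a b c : V) :
    μ.real 𝐒[a, b, c] * μ.real 𝐊[a, b, c] - μ.real 𝐉[a, b, c] * μ.real 𝐉[b, a, c] =
      (μ.real (openConn c a ∩ openConn c b) - μ.real (openConn c a) * μ.real (openConn c b)) -
        μ.real 𝐊[a, b, c] * μ.real 𝐉[c, a, b] := by
  have h5 := real_five_types μ a b c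
  have hca := real_conn_eq μ a b c
  have hcb : μ.real (openConn c b) = μ.real 𝐊[a, b, c] + μ.real 𝐉[a, b, c] := by
    have h := real_conn_eq μ b a c
    have e1 : (𝐊[b, a, c] : Set (BondConfig V)) = 𝐊[a, b, c] := by
      ext ω; simp only [mem_inter_iff, openConn, mem_setOf_eq]
      constructor
      · rintro ⟨⟨h1, h2⟩, h3⟩; exact ⟨⟨h1.symm, h3⟩, h2⟩
      · rintro ⟨⟨h1, h2⟩, h3⟩; exact ⟨⟨h1.symm, h3⟩, h2⟩
    rw [e1] at h; exact h
  have hK : μ.real (openConn c a ∩ openConn c b) = μ.real 𝐊[a, b, c] := by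
    congr 1
    ext ω; simp only [mem_inter_iff, openConn, mem_setOf_eq]
    constructor
    · rintro ⟨h1, h2⟩; exact ⟨⟨h1.symm.trans h2, h1.symm⟩, h2.symm⟩
    · rintro ⟨⟨-, h2⟩, h3⟩; exact ⟨h2.symm, h3.symm⟩
  rw [hca, hcb, hK]
  have hs : μ.real 𝐒[a, b, c] = 1 - μ.real 𝐉[a, b, c] - μ.real 𝐉[b, a, c] - μ.real 𝐉[c, a, b] - μ.real 𝐊[a, b, c] := by
    linarith
  rw [hs]; ring

/-- **SK3 as a lower bound for the Ahlswede–Daykin gap**: `j_c·(j_a + j_b) ≤ s·k − j_a·j_b` (`Consts.SK3.sum_alone_mul_alone_le` rearranged).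
[cite: AhlswedeDaykin1978, Theorem 1] -/
theorem alone_mul_sum_le_gap (w : Sym2 V → unitInterval) (a b c : V) :
    (prodBernoulli w).real 𝐉[c, a, b] * ((prodBernoulli w).real 𝐉[a, b, c] + (prodBernoulli w).real 𝐉[b, a, c]) ≤
      (prodBernoulli w).real 𝐒[a, b, c] * (prodBernoulli w).real 𝐊[a, b, c] -
        (prodBernoulli w).real 𝐉[a, b, c] * (prodBernoulli w).real 𝐉[b, a, c] := by
  have h := sum_alone_mul_alone_le w a b c
  nlinarith [h]

/-- **Quantified Harris inequality at a vertex** (equivalent to SK3): `Cov(1_{c ⟷ a}, 1_{c ⟷ b}) ≥ μ(a ⟷ b, c alone)·μ(c ⟷ a or c ⟷ b)`,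
written as `μ(J_c)·(k + j_a + j_b) ≤ μ(c⟷a, c⟷b) − μ(c⟷a)μ(c⟷b)`. [cite: Harris1960, Lemma 4.1 (the qualitative case)] -/
theorem cov_conn_ge (w : Sym2 V → unitInterval) (a b c : V) :
    (prodBernoulli w).real 𝐉[c, a, b] *
        ((prodBernoulli w).real 𝐊[a, b, c] + (prodBernoulli w).real 𝐉[a, b, c] + (prodBernoulli w).real 𝐉[b, a, c]) ≤
      (prodBernoulli w).real (openConn c a ∩ openConn c b) -
        (prodBernoulli w).real (openConn c a) * (prodBernoulli w).real (openConn c b) := by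
  have h1 := alone_mul_sum_le_gap w a b c
  have h2 := sk_sub_eq_cov (prodBernoulli w) a b c
  nlinarith [h1, h2]

end SK3

/-- **CONJECTURE (Gladkov 2024, Conjecture 10.1; Gladkov–Zimin 2024, Conjecture 6.3) — three-point gap continuity.**  For every `ε > 0`
there is `δ > 0` such that for every finite weighted graph (`Fin n`, weights `w`, `μ = prodBernoulli w`) and vertices `a b c`:
if `μ(a ⟷ b, c alone) < δ` then `μ(a|b|c)·μ(abc) − μ(a alone)·μ(b alone) < ε`  (in the source's notation:
`P(ab|c) < δ ⟹ P(abc)P(a|b|c) − P(ac|b)P(a|bc) < ε`).  OPEN (stated as open in arXiv:2408.08457 §10, "numerical simulations confirm this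
conjecture"; the weaker Theorem 1.3 there — `P(ab|c), P(ac|b) < δ ⟹ P(abc) < ε ∨ P(a|b|c) < ε` — is proved with decision trees).  In this tree the
gap is bounded BELOW by `μ(c alone)·(μ(a alone) + μ(b alone)) ≥ 0` (`Consts.SK3.alone_mul_sum_le_gap`, from SK3) and equals
`Cov(1_{c⟷a}, 1_{c⟷b}) − μ(abc)·μ(c alone)` (`Consts.SK3.sk_sub_eq_cov`); equality `gap = 0` holds when `c` separates `a` from `b`.
Seat numerics (prim-consts-1 gen 14, memo §5(iv); not evidence of more than plausibility): `gap ≤ 0.52·(μ(c alone) + √(μ(c alone)·s·k))` in all climbed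
instances on ≤ 8 vertices, while `gap ≤ μ(c alone)` and `gap² ≤ μ(c alone)·s·k` both FAIL (exact ratios 2.853 and 1.0006).
builds on p205010 (kernel theorem, internal audit signed; external expert review pending).
[cite: Gladkov2024, Conjecture 10.1 (§10) and Theorem 1.3] [status: open] -/
@[conjecture] def ThreePointGapContinuity : Prop :=
  ∀ ε : ℝ, 0 < ε → ∃ δ : ℝ, 0 < δ ∧ ∀ (n : ℕ) (w : Sym2 (Fin n) → unitInterval) (a b c : Fin n),
    (prodBernoulli w).real ((openConn c a)ᶜ ∩ (openConn c b)ᶜ ∩ openConn a b) < δ →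
      (prodBernoulli w).real ((openConn a b)ᶜ ∩ (openConn a c)ᶜ ∩ (openConn b c)ᶜ) *
            (prodBernoulli w).real (openConn a b ∩ openConn a c ∩ openConn b c) -
          (prodBernoulli w).real ((openConn a b)ᶜ ∩ (openConn a c)ᶜ ∩ openConn b c) *
            (prodBernoulli w).real ((openConn b a)ᶜ ∩ (openConn b c)ᶜ ∩ openConn a c) < ε

/-- The gap in `Consts.ThreePointGapContinuity` is always `≥ 0` (indeed `≥ μ(c alone)·(μ(a alone) + μ(b alone))`): the conjecture is a
statement about its upper continuity only. [cite: AhlswedeDaykin1978, Theorem 1] -/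
theorem threePointGap_nonneg {n : ℕ} (w : Sym2 (Fin n) → unitInterval) (a b c : Fin n) :
    0 ≤ (prodBernoulli w).real ((openConn a b)ᶜ ∩ (openConn a c)ᶜ ∩ (openConn b c)ᶜ) *
            (prodBernoulli w).real (openConn a b ∩ openConn a c ∩ openConn b c) -
          (prodBernoulli w).real ((openConn a b)ᶜ ∩ (openConn a c)ᶜ ∩ openConn b c) *
            (prodBernoulli w).real ((openConn b a)ᶜ ∩ (openConn b c)ᶜ ∩ openConn a c) := by
  have h := SK3.alone_mul_sum_le_gap w a b c
  nlinarith [h, measureReal_nonneg (μ := prodBernoulli w) (s := (openConn c a)ᶜ ∩ (openConn c b)ᶜ ∩ openConn a b),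
    measureReal_nonneg (μ := prodBernoulli w) (s := (openConn a b)ᶜ ∩ (openConn a c)ᶜ ∩ openConn b c),
    measureReal_nonneg (μ := prodBernoulli w) (s := (openConn b a)ᶜ ∩ (openConn b c)ᶜ ∩ openConn a c)]

end Consts

end Summit.CriticalPhenomena.PercolationContinuityZ3.Theorems

end
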